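import Mathlib
import Summits.Ventures.PercRepro2.StrandSum

/-!
# Strand reduction for any number of strands (seat mine-b, cell pub-perc-repro2)

`StrandSum.lean` treats a parallel composition of TWO parts covering all edges.  Here the union
theorem is stated for two arbitrary disjoint parts sharing only the terminals
(`isLCTail_flowTail_union'`), so that it can be iterated over the strands of a graph:
`flow_logconcave_of_strands` — if the edge set is partitioned into parts pairwise sharing only
`s, t` and every part has a log-concave flow tail, then so has the whole graph; with
`flowIn_logconcave_of_no_three` this is row B2 for every product measure on every graph all of
whose strands carry at most two edge-disjoint `s–t` paths (`flow_logconcave_of_small_strands`).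
-/

open Finset

namespace Summit.Ventures.PercRepro2

open IFR

variable {V : Type*} {E : Type*} [Fintype E] [DecidableEq E]

/-- the flow events are antitone in the level -/
lemma flowIn_anti (ends : E → Sym2 V) (s t : V) (E₁ : Finset E) :
    Antitone (flowIn ends s t E₁) :=
  antitone_nat_of_succ_le (flowIn_succ_subset ends s t E₁)

/-- the flow of a union of two parts sharing only the terminals -/
theorem flowIn_union_iff {ends : E → Sym2 V} {s t : V} (hst : s ≠ t) {E₁ E₂ : Finset E}
    (hE : SharesOnlyTerminals ends s t E₁ E₂) (hdisj : Disjoint E₁ E₂) (k : ℕ) (ω : Config E) :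
    ω ∈ flowIn ends s t (E₁ ∪ E₂) k ↔
      ∃ j ≤ k, ω ∈ flowIn ends s t E₁ j ∧ ω ∈ flowIn ends s t E₂ (k - j) := by
  have h1 : openSet ω ∩ (E₁ ∪ E₂) ∩ E₁ = openSet ω ∩ E₁ := by
    ext e; simp only [Finset.mem_inter, Finset.mem_union]; tauto
  have h2 : openSet ω ∩ (E₁ ∪ E₂) ∩ E₂ = openSet ω ∩ E₂ := by
    ext e; simp only [Finset.mem_inter, Finset.mem_union]; tauto
  constructor
  · intro h
    obtain ⟨j, hj, hj₁, hj₂⟩ := kDisj_split hst hE k Finset.inter_subset_right h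
    rw [h1] at hj₁; rw [h2] at hj₂
    exact ⟨j, hj, hj₁, hj₂⟩
  · rintro ⟨j, hj, hj₁, hj₂⟩
    have hd : Disjoint (openSet ω ∩ E₁) (openSet ω ∩ E₂) :=
      Finset.disjoint_of_subset_left Finset.inter_subset_right
        (Finset.disjoint_of_subset_right Finset.inter_subset_right hdisj)
    have hm := kDisj_merge j (k - j) hd hj₁ hj₂
    have e : j + (k - j) = k := by omega
    rw [e] at hm
    have hu : openSet ω ∩ E₁ ∪ openSet ω ∩ E₂ = openSet ω ∩ (E₁ ∪ E₂) := by
      rw [← Finset.inter_union_distrib_left]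
    rw [hu] at hm
    exact hm

/-- on the level `F₁ = j` the flow of the union is `≥ k` iff the second part carries `k − j` -/
theorem flowLevel_inter_flowIn_union {ends : E → Sym2 V} {s t : V} (hst : s ≠ t) {E₁ E₂ : Finset E}
    (hE : SharesOnlyTerminals ends s t E₁ E₂) (hdisj : Disjoint E₁ E₂) (k j : ℕ) :
    flowLevel ends s t E₁ j ∩ flowIn ends s t (E₁ ∪ E₂) k
      = flowLevel ends s t E₁ j ∩ flowIn ends s t E₂ (k - j) := by
  ext ω
  simp only [Set.mem_inter_iff, flowLevel, Set.mem_sdiff]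
  have hmono : ∀ (E' : Finset E) (a b : ℕ), a ≤ b → ω ∈ flowIn ends s t E' b → ω ∈ flowIn ends s t E' a :=
    fun E' a b hab hb => flowIn_anti ends s t E' hab hb
  constructor
  · rintro ⟨⟨hj, hj1⟩, hk⟩
    refine ⟨⟨hj, hj1⟩, ?_⟩
    obtain ⟨i, hi, h₁, h₂⟩ := (flowIn_union_iff hst hE hdisj k ω).1 hk
    have hij : i ≤ j := by
      by_contra hlt
      exact hj1 (hmono E₁ (j + 1) i (Nat.lt_of_not_le hlt) h₁)
    exact hmono E₂ (k - j) (k - i) (by omega) h₂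
  · rintro ⟨⟨hj, hj1⟩, h₂⟩
    refine ⟨⟨hj, hj1⟩, ?_⟩
    rw [flowIn_union_iff hst hE hdisj k ω]
    refine ⟨min j k, min_le_right _ _, hmono E₁ _ _ (min_le_left _ _) hj, ?_⟩
    have e : k - min j k = k - j := by omega
    rw [e]; exact h₂

/-- the convolution identity for a union of two parts -/
theorem prob_flowIn_union_eq_sum (p : E → ℝ) {ends : E → Sym2 V} {s t : V} (hst : s ≠ t)
    {E₁ E₂ : Finset E} (hE : SharesOnlyTerminals ends s t E₁ E₂) (hdisj : Disjoint E₁ E₂) (k : ℕ) :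
    prob p (flowIn ends s t (E₁ ∪ E₂) k)
      = ∑ j ∈ Finset.range (E₁.card + 1), prob p (flowLevel ends s t E₁ j) * prob p (flowIn ends s t E₂ (k - j)) := by
  have h0 : prob p (flowIn ends s t (E₁ ∪ E₂) k)
      = prob p (flowIn ends s t (E₁ ∪ E₂) k ∩ (flowIn ends s t E₁ (E₁.card + 1))ᶜ) := by
    rw [flowIn_eq_empty hst E₁ (Nat.lt_succ_self _), Set.compl_empty, Set.inter_univ]
  rw [h0, prob_inter_compl_flowIn_eq_sum]
  refine Finset.sum_congr rfl fun j _ => ?_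
  rw [Set.inter_comm, flowLevel_inter_flowIn_union hst hE hdisj k j]
  exact prob_inter_eq_mul_of_dependsOn p (Finset.disjoint_coe.2 hdisj)
    (dependsOn_flowLevel ends s t E₁ j) (dependsOn_flowIn ends s t E₂ (k - j))

/-- the flow tail of a union in the language of `IFR.Hsum` -/
theorem flowTail_union_eq_Hsum (p : E → ℝ) {ends : E → Sym2 V} {s t : V} (hst : s ≠ t)
    {E₁ E₂ : Finset E} (hE : SharesOnlyTerminals ends s t E₁ E₂) (hdisj : Disjoint E₁ E₂)
    {M : ℤ} (hM : (E₁.card : ℤ) + 1 ≤ M) (k : ℤ) :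
    flowTail p ends s t (E₁ ∪ E₂) k = Hsum (flowTail p ends s t E₂) (flowTail p ends s t E₁) M k := by
  -- natural indices first
  have hnat : ∀ n : ℕ, flowTail p ends s t (E₁ ∪ E₂) (n : ℤ)
      = Hsum (flowTail p ends s t E₂) (flowTail p ends s t E₁) M (n : ℤ) := by
    intro n
    rw [flowTail_natCast, prob_flowIn_union_eq_sum p hst hE hdisj n]
    unfold Hsum
    have hsub : (Finset.range (E₁.card + 1)).image (Nat.cast : ℕ → ℤ) ⊆ I M := by
      intro x hx
      rw [Finset.mem_image] at hx
      obtain ⟨j, hj, rfl⟩ := hx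
      rw [Finset.mem_range] at hj
      unfold I; rw [Finset.mem_Icc]; omega
    rw [← Finset.sum_subset hsub, Finset.sum_image (fun _ _ _ _ h => Nat.cast_injective h)]
    · refine Finset.sum_congr rfl fun j _ => ?_
      rw [pmf_flowTail]
      congr 1
      by_cases hjk : j ≤ n
      · have e : ((n : ℤ) - (j : ℤ)) = ((n - j : ℕ) : ℤ) := by omega
        rw [e, flowTail_natCast]
      · have hlt : n < j := Nat.lt_of_not_le hjk
        rw [flowTail_of_nonpos _ _ _ _ _ (by omega), Nat.sub_eq_zero_of_le hlt.le, flowIn_zero, prob_univ]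
    · intro x hxI hx
      have hx' : ∀ j ∈ Finset.range (E₁.card + 1), (j : ℤ) ≠ x := by
        intro j hj h
        exact hx (Finset.mem_image.2 ⟨j, hj, h⟩)
      rcases lt_or_ge x 0 with hneg | hpos
      · rw [IsLCTail.pmf, flowTail_of_nonpos _ _ _ _ _ (by omega), flowTail_of_nonpos _ _ _ _ _ (by omega)]
        ring
      · have hbig : (E₁.card : ℤ) + 1 ≤ x := by
          by_contra hlt
          have hlt' : x < (E₁.card : ℤ) + 1 := not_le.1 hlt
          have hxn : x = ((x.toNat : ℕ) : ℤ) := (Int.toNat_of_nonneg hpos).symm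
          apply hx' x.toNat (by rw [Finset.mem_range]; omega)
          exact hxn.symm
        have hv : ∀ y : ℤ, (E₁.card : ℤ) + 1 ≤ y → flowTail p ends s t E₁ y = 0 := by
          intro y hy
          rw [flowTail_of_pos _ _ _ _ _ (by omega), flowIn_eq_empty hst E₁ (by omega), prob_empty]
        rw [IsLCTail.pmf, hv x hbig, hv (x + 1) (by omega)]
        ring
  rcases le_or_gt k 0 with hk | hk
  · have h0 := hnat 0
    simp only [Nat.cast_zero] at h0
    rw [flowTail_of_nonpos _ _ _ _ _ le_rfl] at h0
    rw [flowTail_of_nonpos _ _ _ _ _ hk, h0]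
    unfold Hsum
    refine Finset.sum_congr rfl fun x _ => ?_
    rcases le_or_gt x (-1) with hx | hx
    · rw [IsLCTail.pmf, flowTail_of_nonpos _ _ _ _ _ (by omega), flowTail_of_nonpos _ _ _ _ _ (by omega)]
      ring
    · rw [flowTail_of_nonpos _ _ _ _ _ (by omega), flowTail_of_nonpos _ _ _ _ _ (by omega)]
  · have e : k = ((k.toNat : ℕ) : ℤ) := (Int.toNat_of_nonneg hk.le).symm
    rw [e]
    exact hnat _

/-- **union of two parts with log-concave flow tails** -/
theorem isLCTail_flowTail_union' (p : E → ℝ) {ends : E → Sym2 V} {s t : V} (hst : s ≠ t)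
    {E₁ E₂ : Finset E} (hE : SharesOnlyTerminals ends s t E₁ E₂) (hdisj : Disjoint E₁ E₂)
    (h₁ : IsLCTail (flowTail p ends s t E₁) ((E₁.card : ℤ) + 1))
    (h₂ : IsLCTail (flowTail p ends s t E₂) ((E₂.card : ℤ) + 1)) :
    IsLCTail (flowTail p ends s t (E₁ ∪ E₂)) (((E₁ ∪ E₂).card : ℤ) + 1) := by
  have hfun : flowTail p ends s t (E₁ ∪ E₂)
      = Hsum (flowTail p ends s t E₂) (flowTail p ends s t E₁) ((E₁.card : ℤ) + 2) :=
    funext fun k => flowTail_union_eq_Hsum p hst hE hdisj (M := (E₁.card : ℤ) + 2) (by omega) k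
  have h := Hsum_isLCTail h₂ h₁ (M := (E₁.card : ℤ) + 2) (by omega) (by omega)
  rw [hfun]
  -- adjust the support bound: `|E₁ ∪ E₂| + 1 ≤ |E₂| + 1 + (|E₁| + 1)`
  have hcard : ((E₁ ∪ E₂).card : ℤ) + 1 ≤ (E₂.card : ℤ) + 1 + ((E₁.card : ℤ) + 1) := by
    have := Finset.card_union_le E₁ E₂
    omega
  exact ⟨h.one, h.nonneg, h.anti, h.lc, fun k hk => by
    -- vanish at the smaller bound: `Hsum = flowTail (E₁ ∪ E₂)` vanishes beyond `|E₁ ∪ E₂|`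
    rw [← hfun]
    rw [flowTail_of_pos _ _ _ _ _ (by omega), flowIn_eq_empty hst (E₁ ∪ E₂) (by omega), prob_empty]⟩

omit [Fintype E] in
/-- a part sharing only the terminals with each member of a family shares only the terminals
with their union -/
lemma sharesOnlyTerminals_biUnion {ends : E → Sym2 V} {s t : V} {ι : Type*} (P : Finset ι)
    (F : ι → Finset E) (E₀ : Finset E) (h : ∀ i ∈ P, SharesOnlyTerminals ends s t E₀ (F i)) :
    SharesOnlyTerminals ends s t E₀ (P.biUnion F) := by
  intro e₁ h₁ e₂ h₂ v hv₁ hv₂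
  rw [Finset.mem_biUnion] at h₂
  obtain ⟨i, hi, h₂⟩ := h₂
  exact h i hi e₁ h₁ e₂ h₂ v hv₁ hv₂

/-- **strand reduction for a family of strands**: pairwise sharing only the terminals, pairwise
disjoint, each with a log-concave flow tail ⇒ the union has a log-concave flow tail -/
theorem isLCTail_flowTail_biUnion {p : E → ℝ} (hp : IsProbVec p) {ends : E → Sym2 V} {s t : V}
    (hst : s ≠ t) {ι : Type*} [DecidableEq ι] (F : ι → Finset E) :
    ∀ (P : Finset ι),
      (∀ i ∈ P, ∀ j ∈ P, i ≠ j → SharesOnlyTerminals ends s t (F i) (F j)) →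
      (∀ i ∈ P, ∀ j ∈ P, i ≠ j → Disjoint (F i) (F j)) →
      (∀ i ∈ P, IsLCTail (flowTail p ends s t (F i)) (((F i).card : ℤ) + 1)) →
      IsLCTail (flowTail p ends s t (P.biUnion F)) (((P.biUnion F).card : ℤ) + 1) := by
  intro P
  induction P using Finset.induction_on with
  | empty =>
    intro _ _ _
    rw [Finset.biUnion_empty]
    apply isLCTail_flowTail hp hst
    intro k
    rw [flowIn_eq_empty hst ∅ (show (∅ : Finset E).card < k + 2 by simp), prob_empty, mul_zero]
    exact mul_nonneg (prob_nonneg hp _) (prob_nonneg hp _)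
  | insert i P hi ih =>
    intro hsh hdj hlc
    rw [Finset.biUnion_insert]
    have hsh' : SharesOnlyTerminals ends s t (F i) (P.biUnion F) :=
      sharesOnlyTerminals_biUnion P F (F i) fun j hj =>
        hsh i (Finset.mem_insert_self i P) j (Finset.mem_insert_of_mem hj) (fun h => hi (h ▸ hj))
    have hdj' : Disjoint (F i) (P.biUnion F) := by
      rw [Finset.disjoint_biUnion_right]
      intro j hj
      exact hdj i (Finset.mem_insert_self i P) j (Finset.mem_insert_of_mem hj) (fun h => hi (h ▸ hj))
    have hrest := ih (fun a ha b hb hab => hsh a (Finset.mem_insert_of_mem ha) b (Finset.mem_insert_of_mem hb) hab)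
      (fun a ha b hb hab => hdj a (Finset.mem_insert_of_mem ha) b (Finset.mem_insert_of_mem hb) hab)
      (fun a ha => hlc a (Finset.mem_insert_of_mem ha))
    exact isLCTail_flowTail_union' p hst hsh' hdj' (hlc i (Finset.mem_insert_self i P)) hrest

/-- **Row B2 on every graph all of whose strands carry at most two edge-disjoint `s–t` paths**:
for a partition of the edges into parts pairwise sharing only the terminals, each without three
disjoint carrying sets, `P(F ≥ k)·P(F ≥ k+2) ≤ P(F ≥ k+1)²` for every product measure. -/
theorem flow_logconcave_of_small_strands {p : E → ℝ} (hp : IsProbVec p) {ends : E → Sym2 V} {s t : V}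
    (hst : s ≠ t) {ι : Type*} [DecidableEq ι] (F : ι → Finset E) (P : Finset ι)
    (hsh : ∀ i ∈ P, ∀ j ∈ P, i ≠ j → SharesOnlyTerminals ends s t (F i) (F j))
    (hdj : ∀ i ∈ P, ∀ j ∈ P, i ≠ j → Disjoint (F i) (F j))
    (hcov : P.biUnion F = Finset.univ)
    (h3 : ∀ i ∈ P, flowIn ends s t (F i) 3 = ∅) (k : ℕ) :
    prob p (flowEvent ends s t k) * prob p (flowEvent ends s t (k + 2))
      ≤ prob p (flowEvent ends s t (k + 1)) * prob p (flowEvent ends s t (k + 1)) := by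
  have h := isLCTail_flowTail_biUnion hp hst F P hsh hdj fun i hi =>
    isLCTail_flowTail hp hst (F i) (flowIn_logconcave_of_no_three hp ends s t (F i) (h3 i hi))
  rw [hcov] at h
  have hk := h.lc ((k : ℤ) + 1)
  have e1 : ((k : ℤ) + 1 - 1) = (k : ℤ) := by ring
  have e2 : ((k : ℤ) + 1 + 1) = ((k + 2 : ℕ) : ℤ) := by push_cast; ring
  have e3 : ((k : ℤ) + 1) = ((k + 1 : ℕ) : ℤ) := by push_cast; ring
  rw [e1, e2, e3, flowTail_natCast, flowTail_natCast, flowTail_natCast, flowIn_univ, flowIn_univ,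
    flowIn_univ] at hk
  exact hk

end Summit.Ventures.PercRepro2
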